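import Summits.CriticalPhenomena.SAWScalingLimit.Theorems.SAWTotalPositivityCriticalBubbleBoundKestenHWFloor
import Summits.CriticalPhenomena.SAWScalingLimit.Theorems.SAWTotalPositivityCriticalBubbleBoundKestenHWRenewal
import Summits.CriticalPhenomena.SAWScalingLimit.Theorems.SAWTotalPositivityCriticalBubbleBoundKestenHWColumnRenewal
import Summits.CriticalPhenomena.SAWScalingLimit.Theorems.SAWTotalPositivityCriticalBubbleBoundKestenHWStrip
import Summits.CriticalPhenomena.SAWScalingLimit.Theorems.SAWTotalPositivityCriticalBubbleBoundKestenHWStripTransfer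

/-!
# Line `kesten-product-renewal-dictionary` for the crux `SAWTotalPositivity.CriticalBubbleBound`
(stmt-CriticalPhenomena-7117): Kesten's span-renewal structure as EQUALITIES, and the effective
critical strip mass

Assembly of the second c4 wave (lead c4; inputs landed as their own files, namespace
`…Theorems.CriticalBubbleBound.Kesten.HW`):

* R1 `wordSpanMass_renewal` (`…KestenHWRenewal.lean`): in the word model, for every span `L ≥ 1` the
  critical mass `U(L)` of the self-avoiding bridge words of span `L` satisfies the renewal equation
  `U(L) = Σ_{j=1}^{L} Λ(j) U(L−j)` EXACTLY (`Λ(j)` = critical mass of the irreducible bridges of span `j`;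
  unique factorisation `w = s ++ t`, Madras–Slade (4.2.1)–(4.2.2)), and Kesten's identity regrouped by span
  gives `Σ_j Λ(j) = 1`;
* R2 `columnMass_renewal_of` (`…KestenHWColumnRenewal.lean`): the line's renewal density
  `u_h = columnMass h` (vertex-function bridges) IS the word span mass, hence obeys the same equation;
* S8 `stripWordMass_le` (`…KestenHWStrip.lean`) and S9 `stripMass_le_exp_of` (`…KestenHWStripTransfer.lean`):
  the critical mass of the self-avoiding walks confined to a vertical strip of width `h` is at most
  `2μ·4^h`, uniformly in the length (cut at the last minimum, Madras–Slade (3.1.7), plus the critical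
  Hammersley–Welsh bound `halfSpaceWordMass_le_two_pow`).

Here (sorry-free, unconditional): `tsum_irrSpanMass_eq_one` (the inter-arrival law `(Λ(j))_{j ≥ 1}` of
Kesten's renewal process is a probability distribution on the spans), `columnMass_eq_wordSpanMass`,
**`columnMass_renewal`** (`u_h = Σ_{j=1}^{h} Λ(j) u_{h−j}` for `h ≥ 1`: together with `u_0 = 1`,
`u_h ≤ 1` (`Cut.columnMass_le_one`) and `Σ_h u_h = ∞` (`tsum_columnMass_eq_top`) the sequence `(u_h)` is
literally the renewal sequence of a recurrent renewal process — Madras–Slade (4.2.9)–(4.2.12) at `z = z_c`),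
`stripWordMass_le_exp` and **`stripMass_le_exp`** (the `x_c`-generating function of the `n`-step
self-avoiding walks from `0` confined to a strip of width `h` — the very filter of c3's `Strip.strip_gap` — is
`≤ 2μ·4^h`: an EFFECTIVE companion of the ineffective strip gap).

Sources: H. Kesten, *J. Math. Phys.* 4 (1963), §4; N. Madras, G. Slade, *The Self-Avoiding Walk* (1993),
§3.1 eq. (3.1.7), §4.2 (4.2.1)–(4.2.12).
-/

noncomputable section

open Literature.Probability.LatticeModels
open Literature.Probability.RandomPlanarGeometry Literature.Probability.RandomPlanarGeometry.SAW
open scoped ENNReal NNReal BigOperators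
open Classical

namespace Summit.CriticalPhenomena.SAWScalingLimit.Theorems.CriticalBubbleBound.Kesten.HW

/-! ## Kesten's renewal structure as equalities -/

/-- **The inter-arrival law of Kesten's renewal process is a probability distribution on the spans**:
`Σ_{j} Λ(j) = 1`, `Λ(j) = Σ_{β irreducible bridge of span j} x_c^{|β|}` (Kesten's identity
`kestenIdentity` regrouped by the span of the irreducible bridge). [cite: MadrasSlade1993, §4.2, eq. (4.2.4)] -/
theorem tsum_irrSpanMass_eq_one : (∑' j : ℕ, ∑' s : {s : List Step // IsIrrBridge s ∧ xEnd s = (j : ℤ)}, ENNReal.ofReal (criticalFugacity ^ s.1.length)) = 1 :=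
  wordSpanMass_renewal.2 kestenIdentity

/-- **Model identification**: the line's renewal density `u_h = columnMass h` (vertex-function bridges of
`ℤ²` of span `h`) equals the critical mass of the self-avoiding bridge WORDS of span `h`.
[cite: MadrasSlade1993, §4.2] -/
theorem columnMass_eq_wordSpanMass : ∀ h : ℕ, columnMass h = ∑' w : {w : List Step // IsSAW w ∧ IsBridgeW w ∧ xEnd w = (h : ℤ)}, ENNReal.ofReal (criticalFugacity ^ w.1.length) :=
  (columnMass_renewal_of wordSpanMass_renewal.1).1

/-- **The span-renewal equation** (Madras–Slade (4.2.9)–(4.2.12) at `z = z_c`, as an EQUALITY): for `h ≥ 1`,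
`u_h = Σ_{j=1}^{h} Λ(j) · u_{h−j}` — every bridge of span `h ≥ 1` is uniquely an irreducible bridge of span
`j ≥ 1` followed by a bridge of span `h − j`. With `u_0 = 1`, `u_h ≤ 1` and `Σ_h u_h = ∞`, `(u_h)` is the
renewal sequence of a recurrent renewal process with inter-arrival law `Λ`. [cite: MadrasSlade1993, §4.2, eq. (4.2.9)–(4.2.12)] -/
theorem columnMass_renewal : ∀ h : ℕ, 1 ≤ h → columnMass h = ∑ j ∈ Finset.Icc 1 h, (∑' s : {s : List Step // IsIrrBridge s ∧ xEnd s = (j : ℤ)}, ENNReal.ofReal (criticalFugacity ^ s.1.length)) * columnMass (h - j) :=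
  (columnMass_renewal_of wordSpanMass_renewal.1).2

/-! ## The effective critical strip mass -/

/-- **Critical SAW words confined to a strip of width `h` have total mass `≤ 2μ·4^h`**, uniformly in the
length cut-off: `stripWordMass_le` applied to `halfSpaceWordMass_le_two_pow`. [cite: MadrasSlade1993, §3.1, eq. (3.1.7)] -/
theorem stripWordMass_le_exp : ∀ N h : ℕ, (∑ w ∈ (Finset.range (N + 1)).biUnion (fun n => (sawWords n).filter (fun w => ∀ i ≤ w.length, ∀ i' ≤ w.length, xAt w i ≤ xAt w i' + (h : ℤ))), criticalFugacity ^ w.length) ≤ 2 * connectiveConstant * 4 ^ h :=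
  stripWordMass_le halfSpaceWordMass_le_two_pow

/-- **Effective critical strip bound** (vertex functions): the `x_c`-generating function of the `n`-step
self-avoiding walks of `ℤ²` from `0` all of whose first coordinates lie within `h` of each other — the
filter of the strip gap `Strip.strip_gap` — is at most `2μ·4^h`; in particular it is FINITE AT `x_c` with an
explicit constant (the strip gap gives exponential decay of the counts against `μⁿ`, but with ineffective
constants). [cite: MadrasSlade1993, §3.1 and §8.1] -/
theorem stripMass_le_exp : ∀ h : ℕ, (∑' n : ℕ, (((Zd.saws 2 n).filter (fun ω => ∀ i ≤ n, ∀ i' ≤ n, ω i 0 ≤ ω i' 0 + (h : ℤ))).card : ℝ≥0∞) * ENNReal.ofReal (criticalFugacity ^ n)) ≤ ENNReal.ofReal (2 * connectiveConstant * 4 ^ h) :=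
  stripMass_le_exp_of stripWordMass_le_exp

end Summit.CriticalPhenomena.SAWScalingLimit.Theorems.CriticalBubbleBound.Kesten.HW

end
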